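import Mathlib
import Summits.MatrixMultiplication.MatrixMultiplication.Theses.MatrixPointInterpolation

/-!
# `MatrixPointInterpolation.TightWindows` (stmt-MatrixMultiplication-18939) — Negative lane:
# the five-point corner pair, part 2: the few-letters fact for identities of `M_k(ℂ)`

Helper (no Theses conclusion, no new definition).  FEW LETTERS (`coeff_eq_zero_of_count_lt`,
folklore — the two-letter form of the staircase argument, Kanel-Belov–Karasik–Rowen 2015
Remark 1.4.2): if `Σ_{w ∈ T} c_w w(B) = 0` for all pairs `B ∈ M_k(ℂ)²`, then `c_w = 0` for every
`w ∈ T` with fewer than `k` letters `1`.  Proof: at the staircase pair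
`x = diag(d₀,…,d_{k-1})`, `y = Σ E_{t,t+1}` the entry `(i, c)` of `w(B)` is
`[c = i + #y(w)] · Π_t d_{i+t}^{bE w t}` (`bE w t` = number of letters `0` preceded by exactly `t`
letters `1`), so the entry `(0, j)` of the identity is the evaluation at `d` of the polynomial
`Σ_{#y(w) = j} c_w X^{bE w} ∈ ℂ[X₀, X₁, …]`; a word is determined by `(#y, bE)`, so the monomials
are distinct and `MvPolynomial.funext` (ℂ infinite) makes every coefficient vanish.
-/

namespace Summit.MatrixMultiplication.MatrixMultiplication.Theorems

namespace TightWindowsNeg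

open scoped BigOperators

/-- **Few letters.** A two-letter identity of `M_k(ℂ)` has zero coefficient on every word with
fewer than `k` letters `1`. [folklore] -/
theorem coeff_eq_zero_of_count_lt (k : ℕ) (T : Finset (List (Fin 2))) (c : List (Fin 2) → ℂ)
    (hid : ∀ B : Fin 2 → Matrix (Fin k) (Fin k) ℂ, (∑ w ∈ T, c w • (w.map B).prod) = 0)
    (w₀ : List (Fin 2)) (hw₀ : w₀ ∈ T) (hlt : w₀.count 1 < k) : c w₀ = 0 := by
  classical
  -- the objects: upper shift, staircase pair, block exponents
  let U : Matrix (Fin k) (Fin k) ℂ := Matrix.of fun a b => if (b : ℕ) = (a : ℕ) + 1 then 1 else 0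
  let B : (ℕ → ℂ) → Fin 2 → Matrix (Fin k) (Fin k) ℂ := fun d =>
    ![Matrix.diagonal fun s : Fin k => d s, U]
  let bE : List (Fin 2) → ℕ →₀ ℕ := fun w =>
    w.foldr (fun l e => if l = 0 then e + Finsupp.single 0 1 else Finsupp.mapDomain (· + 1) e) 0
  have B_zero : ∀ d, B d 0 = Matrix.diagonal fun s : Fin k => d s := fun d => rfl
  have B_one : ∀ d, B d 1 = U := fun d => rfl
  have bE_nil : bE [] = 0 := rfl
  have bE_cons_zero : ∀ w, bE (0 :: w) = bE w + Finsupp.single 0 1 := fun w => by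
    simp [bE]
  have bE_cons_one : ∀ w, bE (1 :: w) = Finsupp.mapDomain (· + 1) (bE w) := fun w => by
    simp [bE]
  -- left multiplication by the upper shift moves row `i+1` to row `i`
  have U_mul : ∀ (M : Matrix (Fin k) (Fin k) ℂ) (i c : Fin k),
      (U * M) i c = if h : (i : ℕ) + 1 < k then M ⟨(i : ℕ) + 1, h⟩ c else 0 := by
    intro M i c
    simp only [Matrix.mul_apply, U, Matrix.of_apply]
    by_cases h : (i : ℕ) + 1 < k
    · rw [dif_pos h, Finset.sum_eq_single ⟨(i : ℕ) + 1, h⟩]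
      · simp
      · intro s _ hs
        have : (s : ℕ) ≠ (i : ℕ) + 1 := fun e => hs (Fin.ext e)
        simp [this]
      · intro hs
        exact absurd (Finset.mem_univ _) hs
    · rw [dif_neg h]
      refine Finset.sum_eq_zero fun s _ => ?_
      have : (s : ℕ) ≠ (i : ℕ) + 1 := by have := s.is_lt; omega
      simp [this]
  -- entry formula for words at the staircase pair
  have entry : ∀ (d : ℕ → ℂ) (w : List (Fin 2)) (i c : Fin k),
      (w.map (B d)).prod i c =
        if (c : ℕ) = (i : ℕ) + w.count 1 then (bE w).prod (fun t a => d (i + t) ^ a) else 0 := by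
    intro d w
    induction w with
    | nil =>
      intro i c
      rw [bE_nil]
      simp only [List.map_nil, List.prod_nil, Matrix.one_apply, List.count_nil, add_zero,
        Finsupp.prod_zero_index]
      by_cases h : i = c
      · subst h; simp
      · have h' : (c : ℕ) ≠ (i : ℕ) := fun e => h (Fin.ext e.symm)
        simp [h, h']
    | cons l w ih =>
      intro i c
      have hc := c.is_lt
      rw [List.map_cons, List.prod_cons]
      obtain rfl | rfl : l = 0 ∨ l = 1 := by fin_cases l <;> simp
      · -- the diagonal letter
        rw [B_zero, Matrix.diagonal_mul, ih, bE_cons_zero]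
        simp only [List.count_cons, Fin.isValue]
        simp only [Fin.isValue, zero_ne_one, beq_iff_eq, if_false, add_zero]
        rw [Finsupp.prod_add_index']
        · rw [Finsupp.prod_single_index]
          · simp only [add_zero, pow_one]
            split_ifs
            · ring
            · simp
          · simp
        · intro t
          simp
        · intro t a b
          rw [pow_add]
      · -- the shift letter
        rw [B_one, U_mul, bE_cons_one]
        simp only [List.count_cons, Fin.isValue, beq_self_eq_true, if_true]
        by_cases hi : (i : ℕ) + 1 < k
        · rw [dif_pos hi, ih]
          rw [Finsupp.prod_mapDomain_index]
          · by_cases hc' : (c : ℕ) = (i : ℕ) + 1 + w.count 1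
            · rw [if_pos hc', if_pos (by omega)]
              apply Finsupp.prod_congr
              intro t _
              congr 2
              dsimp only
              omega
            · rw [if_neg hc', if_neg (by omega)]
          · intro t
            simp
          · intro t a b
            rw [pow_add]
        · rw [dif_neg hi, if_neg (by omega)]
  -- block `0` detects the first letter
  have bE_one_apply_zero : ∀ w, bE (1 :: w) 0 = 0 := by
    intro w
    rw [bE_cons_one]
    exact Finsupp.mapDomain_notin_range _ _ (by simp)
  have bE_zero_apply_zero : ∀ w, bE (0 :: w) 0 = bE w 0 + 1 := by
    intro w
    rw [bE_cons_zero]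
    simp
  -- a word is determined by its number of letters `1` and its block exponents
  have inj : ∀ u v : List (Fin 2), u.count 1 = v.count 1 → bE u = bE v → u = v := by
    intro u
    induction u with
    | nil =>
      intro v hc he
      cases v with
      | nil => rfl
      | cons l v =>
        exfalso
        obtain rfl | rfl : l = 0 ∨ l = 1 := by fin_cases l <;> simp
        · have := DFunLike.congr_fun he 0
          rw [bE_zero_apply_zero, bE_nil] at this
          simp at this
        · simp at hc
    | cons l u ih =>
      intro v hc he
      cases v with
      | nil =>
        exfalso
        obtain rfl | rfl : l = 0 ∨ l = 1 := by fin_cases l <;> simp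
        · have := DFunLike.congr_fun he 0
          rw [bE_zero_apply_zero, bE_nil] at this
          simp at this
        · simp at hc
      | cons l' v =>
        obtain rfl | rfl : l = 0 ∨ l = 1 := by fin_cases l <;> simp
        · obtain rfl | rfl : l' = 0 ∨ l' = 1 := by fin_cases l' <;> simp
          · have he' : bE u = bE v := by
              rw [bE_cons_zero, bE_cons_zero] at he
              exact add_right_cancel he
            have hc' : u.count 1 = v.count 1 := by simpa using hc
            rw [ih v hc' he']
          · exfalso
            have := DFunLike.congr_fun he 0
            rw [bE_zero_apply_zero, bE_one_apply_zero] at this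
            omega
        · obtain rfl | rfl : l' = 0 ∨ l' = 1 := by fin_cases l' <;> simp
          · exfalso
            have := DFunLike.congr_fun he 0
            rw [bE_zero_apply_zero, bE_one_apply_zero] at this
            omega
          · have he' : bE u = bE v := by
              rw [bE_cons_one, bE_cons_one] at he
              exact Finsupp.mapDomain_injective (add_left_injective 1) he
            have hc' : u.count 1 = v.count 1 := by simpa using hc
            rw [ih v hc' he']
  -- the main argument
  have hk : 0 < k := by omega
  set j := w₀.count 1 with hj
  -- entry (0, j) of the identity at the staircase pair, as a function of the diagonal `d`
  have key : ∀ d : ℕ → ℂ,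
      (∑ w ∈ T, if w.count 1 = j then c w * (bE w).prod (fun t a => d t ^ a) else 0) = 0 := by
    intro d
    have h := congr_fun (congr_fun (hid (B d)) ⟨0, hk⟩) ⟨j, hlt⟩
    rw [Matrix.sum_apply, Matrix.zero_apply] at h
    refine Eq.trans (Finset.sum_congr rfl fun w _ => ?_) h
    rw [Matrix.smul_apply, entry, smul_eq_mul]
    simp only [zero_add, mul_ite, mul_zero]
    by_cases hw : w.count 1 = j
    · rw [if_pos hw, if_pos hw.symm]
    · rw [if_neg hw, if_neg (fun e => hw e.symm)]
  -- the polynomial whose evaluations these are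
  set F : MvPolynomial ℕ ℂ :=
    ∑ w ∈ T.filter (fun w => w.count 1 = j), MvPolynomial.monomial (bE w) (c w) with hF
  have hF0 : F = 0 := by
    apply MvPolynomial.funext
    intro d
    rw [map_zero, hF, map_sum, Finset.sum_filter]
    refine Eq.trans (Finset.sum_congr rfl fun w _ => ?_) (key d)
    split_ifs
    · rw [MvPolynomial.eval_monomial]
    · rfl
  have hcoeff := congrArg (MvPolynomial.coeff (bE w₀)) hF0
  rw [MvPolynomial.coeff_zero, hF, MvPolynomial.coeff_sum] at hcoeff
  simp only [MvPolynomial.coeff_monomial] at hcoeff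
  have hmem : w₀ ∈ T.filter (fun w => w.count 1 = j) := Finset.mem_filter.2 ⟨hw₀, hj.symm⟩
  rw [Finset.sum_eq_single_of_mem w₀ hmem] at hcoeff
  · simpa using hcoeff
  · intro w hw hne
    rw [if_neg]
    intro he
    apply hne
    exact inj w w₀ ((Finset.mem_filter.1 hw).2.trans hj.symm) he

end TightWindowsNeg

end Summit.MatrixMultiplication.MatrixMultiplication.Theorems
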